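import Mathlib
import Literature.NumberTheory.Irrationality.BrownZudilin2022.WellPoisedDual
import Literature.NumberTheory.Irrationality.CressonFischlerRivoal2008.WellPoisedSymmetry
import Summits.KontsevichZagierPeriods.Zeta5Search.DualSeriesDecomposition
import Summits.KontsevichZagierPeriods.Zeta5Search.CriteriaDimension
import HarnessLib

/-!
# The dual very-well-poised series `F̃₉(b)`: polynomial form and decomposition in `1, ζ(3), ζ(5), ζ(7)`
# (cell `pub-zeta5`, PROVER 3 — the `k = 9` object of the T2 lane)

HONEST FRAMING: systematic search; no irrationality claim unless certified.

The `k = 9` analogue of the typer's `DualSeriesDecomposition.lean` (`k = 7`, `F̃₇(b) ∈ ℚ + ℚζ(3) + ℚζ(5)`), for the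
families of the cell's intermediate target T2 ("one of `ζ(5), ζ(7)`"): Zudilin's / Brown–Zudilin's dual
very-well-poised series `F̃₉(b)` (`Literature.NumberTheory.Irrationality.BrownZudilin2022.vwpDual 9 b`,
arXiv:2210.03391 (34); Zudilin, JTNB 16 (2004) §8 with `q = 9`, `r = 1`; the `fam-vwp` rays `β·n` of
`families/vwp`, e.g. `β = (3; 1⁹)`), built on the same two Literature objects: `vwpDual_eq_tsum` and
Cresson–Fischler–Rivoal's Théorème 1 (`theoreme1_holds`, PROVED), now with `A = 8`, `n = b₀`.

For INTEGER parameters `b = (b₀; b₁,…,b₉)` with `0 ≤ b₀`, `0 ≤ b_j ≤ b₀ + 1` (`InBox b`):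
* `term b μ` — the `μ`-th term of (34) for `k = 9` (`vwpDual_nine_eq_tsum`);
* `numPoly b = (2X + b₀) · ∏_{j=1}^{9} (X)_{b_j} (X + b₀ − b_j + 1)_{b_j}` and the POLYNOMIAL FORM
  `term b μ = numPoly_b(μ+1) / (μ+1)_{b₀+1}^8` (`term_eq`; the sign `(−1)^{10μ} = 1`);
* `natDegree (numPoly b) ≤ 1 + 2 Σ_j b_j`, the well-poised REFLECTION `numPoly_b(−b₀−X) = −numPoly_b(X)`
  `= (−1)^{8(b₀+1)+1} numPoly_b(X)` — Cresson–Fischler–Rivoal's hypotheses with `A = 8` as soon as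
  `Σ_j b_j ≤ 4b₀ + 2`;
* hence `exists_hasSum_term`, `summable_term`, **`vwpDual_nine_mem`**: the series converges and
  `F̃₉(b) = u·ζ(7) + w·ζ(5) + x·ζ(3) − v` with RATIONAL `u, w, x, v`; `vwpDual_nine_mem_span`: `F̃₉(b)` is a
  `ℚ`-form in `thetaFour = (1, ζ(3), ζ(5), ζ(7))` (`CriteriaDimension.lean`), the input shape of the T2 criteria
  `zetaFiveOrSeven_of_fourTermForms` / `zetaFiveOrSeven_of_divisorForms` (after denominators) and of the
  elimination route `zetaFiveOrSeven_of_certificate` (after a `ζ(3)`-eliminating combination).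
Generic Pochhammer/Gamma bookkeeping (`rp`, `Gamma_add_nat_eq`, `aeval_pochPoly`, `poch_eq_rp`,
`natDegree_pochPoly_le`, `poch_pair_reflect`) is reused from `DualSeries` (the `k = 7` file). Everything is PROVED
(0 sorry); no denominator statement (Zudilin 2004 (9.3) / §9 Conjecture for `q = 9`) is claimed here.
-/

noncomputable section

open Finset Polynomial

namespace Summit.KontsevichZagierPeriods.Zeta5Search.DualSeriesNine

open Literature.NumberTheory.Irrationality.BrownZudilin2022 (vwpDual vwpDual_eq_tsum)
open Literature.NumberTheory.Irrationality.CressonFischlerRivoal2008 (poch theoreme1_holds)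
open Literature.NumberTheory.Transcendental (zetaValue)
open Literature.NumberTheory.Transcendental.BallRivoal (pochPoly eval_pochPoly poch_reflect)
open Summit.KontsevichZagierPeriods.Zeta5Search.DualSeries (rp rp_add rp_pos Gamma_add_nat_eq aeval_pochPoly
  poch_eq_rp natDegree_pochPoly_le poch_pair_reflect)

/-! ### The objects -/

/-- The integer box on which the polynomial form holds: `0 ≤ b₀` and `0 ≤ b_{j+1} ≤ b₀ + 1` for `j < 9`. -/
def InBox (b : ℕ → ℤ) : Prop := 0 ≤ b 0 ∧ ∀ j ∈ range 9, 0 ≤ b (j + 1) ∧ b (j + 1) ≤ b 0 + 1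

/-- The `μ`-th term of the series (34) for `k = 9`, literally as in `vwpDual_eq_tsum`. -/
def term (b : ℕ → ℤ) (μ : ℕ) : ℝ :=
  ((b 0 : ℝ) + 2 * μ + 2) *
      ((Real.Gamma ((b 0 : ℝ) + μ + 2) * ∏ j ∈ range 9, Real.Gamma ((b (j + 1) : ℝ) + μ + 1)) /
        ((μ.factorial : ℝ) * ∏ j ∈ range 9, Real.Gamma ((b 0 : ℝ) - b (j + 1) + μ + 2))) *
    (-1 : ℝ) ^ ((9 + 1) * μ)

/-- `F̃₉(b) = Σ_μ term b μ` (the printed series (34), `k = 9`). -/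
theorem vwpDual_nine_eq_tsum (b : ℕ → ℤ) : vwpDual 9 b = ∑' μ : ℕ, term b μ :=
  vwpDual_eq_tsum 9 b

/-- The numerator polynomial `numPoly b = (2X + b₀) · ∏_{j=1}^{9} (X)_{b_j} · (X + b₀ − b_j + 1)_{b_j} ∈ ℚ[X]`
(Pochhammer factors as `BallRivoal.pochPoly`; `b_j` through `Int.toNat`). -/
def numPoly (b : ℕ → ℤ) : ℚ[X] :=
  (C 2 * X + C (b 0 : ℚ)) *
    ∏ j ∈ range 9, (pochPoly 0 (b (j + 1)).toNat * pochPoly ((b 0 - b (j + 1) + 1 : ℤ) : ℚ) (b (j + 1)).toNat)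

/-- `aeval y (numPoly b) = (2y + b₀) ∏_j (y)_{b_j} (y + b₀ − b_j + 1)_{b_j}`. -/
theorem aeval_numPoly (b : ℕ → ℤ) (y : ℝ) :
    aeval y (numPoly b) = (2 * y + b 0) * ∏ j ∈ range 9,
      (rp y (b (j + 1)).toNat * rp (y + ((b 0 - b (j + 1) + 1 : ℤ) : ℝ)) (b (j + 1)).toNat) := by
  unfold numPoly
  rw [map_mul, map_prod]
  congr 1
  · rw [map_add, map_mul, aeval_C, aeval_X, aeval_C, eq_ratCast, eq_ratCast]
    push_cast
    ring
  · refine prod_congr rfl fun j _ => ?_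
    rw [map_mul, aeval_pochPoly, aeval_pochPoly]
    simp only [Rat.cast_zero, add_zero, Rat.cast_intCast]

/-! ### The polynomial form of the summand -/

/-- The algebra behind `term_eq`: with `∏_j G_j g_j = (r₀ m)^9`,
`X · (r₀ m ∏_j f_j m)/(m ∏_j G_j) = X ∏_j f_j g_j / r₀^8`. -/
theorem key_identity (X m r₀ : ℝ) (f g G : ℕ → ℝ) (hm : m ≠ 0) (hr : r₀ ≠ 0)
    (hG : ∀ j ∈ range 9, G j ≠ 0) (hGg : ∀ j ∈ range 9, G j * g j = r₀ * m) :
    X * ((r₀ * m * ∏ j ∈ range 9, (f j * m)) / (m * ∏ j ∈ range 9, G j)) =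
      X * (∏ j ∈ range 9, (f j * g j)) / r₀ ^ 8 := by
  have hP : (∏ j ∈ range 9, G j) * ∏ j ∈ range 9, g j = (r₀ * m) ^ 9 := by
    rw [← prod_mul_distrib, prod_congr rfl hGg, prod_const, card_range]
  have hden : m * ∏ j ∈ range 9, G j ≠ 0 := mul_ne_zero hm (prod_ne_zero_iff.2 hG)
  rw [mul_div_assoc', div_eq_div_iff hden (pow_ne_zero _ hr), prod_mul_distrib, prod_mul_distrib,
    prod_const, card_range]
  linear_combination (-(X * m * ∏ j ∈ range 9, f j)) * hP

/-- POLYNOMIAL FORM of the summand of (34) (`k = 9`): on the box every Gamma value is taken at a positive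
integer, and `term b μ = numPoly_b(μ+1) / (μ+1)_{b₀+1}^8`. -/
theorem term_eq (b : ℕ → ℤ) (hb : InBox b) (μ : ℕ) :
    term b μ = aeval ((μ : ℝ) + 1) (numPoly b) / poch (μ + 1) (b 0).toNat ^ 8 := by
  obtain ⟨h0, hj⟩ := hb
  set B := (b 0).toNat with hB
  set x : ℝ := (μ : ℝ) + 1 with hx
  have x_pos : 0 < x := by positivity
  have hb0 : (b 0 : ℝ) = (B : ℝ) := by
    have h := Int.toNat_of_nonneg h0
    rw [hB]
    exact_mod_cast h.symm
  have hbj : ∀ j ∈ range 9, (b (j + 1) : ℝ) = ((b (j + 1)).toNat : ℝ) := fun j hj' => by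
    have h := Int.toNat_of_nonneg (hj j hj').1
    exact_mod_cast h.symm
  have hle : ∀ j ∈ range 9, (b (j + 1)).toNat ≤ B + 1 := fun j hj' => by
    have h := (hj j hj').2
    omega
  -- `γ_j = B + 1 - b_j` as a natural number, and its casts
  have hγ : ∀ j ∈ range 9, ((B + 1 - (b (j + 1)).toNat : ℕ) : ℝ) = (b 0 : ℝ) - b (j + 1) + 1 := fun j hj' => by
    rw [Nat.cast_sub (hle j hj'), hb0, hbj j hj']
    push_cast
    ring
  have hfact : Real.Gamma x = (μ.factorial : ℝ) := Real.Gamma_nat_eq_factorial μ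
  have hfact_ne : (μ.factorial : ℝ) ≠ 0 := by positivity
  have hΓ0 : Real.Gamma ((b 0 : ℝ) + μ + 2) = rp x (B + 1) * (μ.factorial : ℝ) := by
    rw [show (b 0 : ℝ) + μ + 2 = x + ((B + 1 : ℕ) : ℝ) by rw [hb0, hx]; push_cast; ring,
      Gamma_add_nat_eq x x_pos, hfact]
  have hΓ1 : ∀ j ∈ range 9, Real.Gamma ((b (j + 1) : ℝ) + μ + 1) =
      rp x (b (j + 1)).toNat * (μ.factorial : ℝ) := fun j hj' => by
    rw [show (b (j + 1) : ℝ) + μ + 1 = x + ((b (j + 1)).toNat : ℝ) by rw [hbj j hj', hx]; ring,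
      Gamma_add_nat_eq x x_pos, hfact]
  have hΓ2 : ∀ j ∈ range 9, Real.Gamma ((b 0 : ℝ) - b (j + 1) + μ + 2) =
      rp x (B + 1 - (b (j + 1)).toNat) * (μ.factorial : ℝ) := fun j hj' => by
    rw [show (b 0 : ℝ) - b (j + 1) + μ + 2 = x + ((B + 1 - (b (j + 1)).toNat : ℕ) : ℝ) by
        rw [hγ j hj', hx]; ring,
      Gamma_add_nat_eq x x_pos, hfact]
  have hsplit : ∀ j ∈ range 9, rp x (B + 1 - (b (j + 1)).toNat) *
      rp (x + ((B + 1 - (b (j + 1)).toNat : ℕ) : ℝ)) (b (j + 1)).toNat = rp x (B + 1) := fun j hj' => by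
    rw [← rp_add]
    congr 1
    have := hle j hj'
    omega
  have hr : rp x (B + 1) ≠ 0 := (rp_pos x_pos _).ne'
  have hsign : (-1 : ℝ) ^ ((9 + 1) * μ) = 1 := by
    rw [pow_mul]
    norm_num
  -- rewrite both sides into the shape of `key_identity`
  unfold term
  rw [hsign, mul_one, hΓ0, prod_congr rfl hΓ1, aeval_numPoly, poch_eq_rp, ← hx,
    show (b 0 : ℝ) + 2 * μ + 2 = 2 * x + b 0 by rw [hx]; ring]
  have hg : ∀ j ∈ range 9, rp x (b (j + 1)).toNat * rp (x + ((b 0 - b (j + 1) + 1 : ℤ) : ℝ)) (b (j + 1)).toNat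
      = rp x (b (j + 1)).toNat * rp (x + ((B + 1 - (b (j + 1)).toNat : ℕ) : ℝ)) (b (j + 1)).toNat :=
    fun j hj' => by
      rw [hγ j hj']
      push_cast
      ring_nf
  rw [prod_congr rfl hg]
  refine key_identity (2 * x + b 0) (μ.factorial : ℝ) (rp x (B + 1)) (fun j => rp x (b (j + 1)).toNat)
    (fun j => rp (x + ((B + 1 - (b (j + 1)).toNat : ℕ) : ℝ)) (b (j + 1)).toNat)
    (fun j => Real.Gamma ((b 0 : ℝ) - b (j + 1) + μ + 2)) hfact_ne hr ?_ ?_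
  · intro j hj'
    rw [hΓ2 j hj']
    exact mul_ne_zero (rp_pos x_pos _).ne' hfact_ne
  · intro j hj'
    rw [hΓ2 j hj', mul_right_comm, hsplit j hj']


/-! ### Degree and reflection of `numPoly` (the hypotheses of Cresson–Fischler–Rivoal, Théorème 1) -/

/-- `deg numPoly_b ≤ 1 + 2 Σ_j b_j`. -/
theorem natDegree_numPoly_le (b : ℕ → ℤ) :
    (numPoly b).natDegree ≤ 1 + 2 * ∑ j ∈ range 9, (b (j + 1)).toNat := by
  unfold numPoly
  refine natDegree_mul_le.trans ?_
  have h1 : (C (2 : ℚ) * X + C (b 0 : ℚ)).natDegree ≤ 1 := natDegree_linear_le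
  have h2 : (∏ j ∈ range 9, (pochPoly 0 (b (j + 1)).toNat *
      pochPoly ((b 0 - b (j + 1) + 1 : ℤ) : ℚ) (b (j + 1)).toNat)).natDegree ≤
      ∑ j ∈ range 9, 2 * (b (j + 1)).toNat := by
    refine (natDegree_prod_le _ _).trans (sum_le_sum fun j _ => ?_)
    refine natDegree_mul_le.trans ?_
    have e1 := natDegree_pochPoly_le 0 (b (j + 1)).toNat
    have e2 := natDegree_pochPoly_le ((b 0 - b (j + 1) + 1 : ℤ) : ℚ) (b (j + 1)).toNat
    omega
  calc _ ≤ 1 + ∑ j ∈ range 9, 2 * (b (j + 1)).toNat := add_le_add h1 h2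
    _ = _ := by rw [mul_sum]

/-- `numPoly_b(t) = (2t + b₀) ∏_j (t)_{b_j} (t + b₀ − b_j + 1)_{b_j}` over `ℚ`. -/
theorem eval_numPoly (b : ℕ → ℤ) (t : ℚ) :
    (numPoly b).eval t = (2 * t + b 0) * ∏ j ∈ range 9,
      (Literature.NumberTheory.Transcendental.BallRivoal.poch t (b (j + 1)).toNat *
        Literature.NumberTheory.Transcendental.BallRivoal.poch
          (t + ((b 0 - b (j + 1) + 1 : ℤ) : ℚ)) (b (j + 1)).toNat) := by
  unfold numPoly
  rw [eval_mul, eval_prod]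
  congr 1
  · simp
  · refine prod_congr rfl fun j _ => ?_
    rw [eval_mul, eval_pochPoly, eval_pochPoly, add_zero]

/-- The well-poised REFLECTION: `numPoly_b(−b₀ − X) = −numPoly_b(X) = (−1)^{8(b₀+1)+1} numPoly_b(X)`
(the symmetry hypothesis of Cresson–Fischler–Rivoal's Théorème 1 with `A = 8`, `n = b₀`). -/
theorem numPoly_reflect (b : ℕ → ℤ) (hb : InBox b) :
    (numPoly b).comp (-((b 0).toNat : ℚ[X]) - X) =
      (-1 : ℚ[X]) ^ (8 * ((b 0).toNat + 1) + 1) * numPoly b := by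
  obtain ⟨h0, hj⟩ := hb
  have hb0 : (((b 0).toNat : ℕ) : ℚ) = (b 0 : ℚ) := by exact_mod_cast Int.toNat_of_nonneg h0
  have hbj : ∀ j ∈ range 9, (((b (j + 1)).toNat : ℕ) : ℚ) = (b (j + 1) : ℚ) := fun j hj' => by
    exact_mod_cast Int.toNat_of_nonneg (hj j hj').1
  apply Polynomial.funext
  intro t
  rw [eval_comp, eval_sub, eval_neg, eval_natCast, eval_X, eval_mul, eval_pow, eval_neg, eval_one,
    Odd.neg_one_pow ⟨4 * ((b 0).toNat + 1), by ring⟩, eval_numPoly, eval_numPoly, hb0, neg_one_mul]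
  have hfac : ∀ j ∈ range 9,
      Literature.NumberTheory.Transcendental.BallRivoal.poch (-(b 0 : ℚ) - t) (b (j + 1)).toNat *
        Literature.NumberTheory.Transcendental.BallRivoal.poch
          (-(b 0 : ℚ) - t + ((b 0 - b (j + 1) + 1 : ℤ) : ℚ)) (b (j + 1)).toNat =
      Literature.NumberTheory.Transcendental.BallRivoal.poch t (b (j + 1)).toNat *
        Literature.NumberTheory.Transcendental.BallRivoal.poch
          (t + ((b 0 - b (j + 1) + 1 : ℤ) : ℚ)) (b (j + 1)).toNat := fun j hj' =>
    poch_pair_reflect t (b 0) _ _ (by rw [hbj j hj']; push_cast; ring)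
  rw [prod_congr rfl hfac]
  ring

/-! ### Convergence and the decomposition `F̃₉(b) ∈ ℚ + ℚζ(3) + ℚζ(5) + ℚζ(7)` -/

/-- The odd integers in `[3, 8]` are `3`, `5` and `7`. -/
theorem filter_odd_Icc_three_eight : (Icc 3 8).filter Odd = ({3, 5, 7} : Finset ℕ) := by decide

/-- Cresson–Fischler–Rivoal's Théorème 1 applied to `numPoly b` (`A = 8`, `n = b₀`): for `b` in the box with
`Σ_j b_j ≤ 3b₀ + 1` the series (34) converges to `a₀ + a₃ζ(3) + a₅ζ(5)` with rational `a`. -/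
theorem exists_hasSum_term (b : ℕ → ℤ) (hb : InBox b) (hsum : ∑ j ∈ range 9, b (j + 1) ≤ 4 * b 0 + 2) :
    ∃ a : ℕ → ℚ, HasSum (term b)
      ((a 0 : ℝ) + ((a 3 : ℝ) * zetaValue 3 + ((a 5 : ℝ) * zetaValue 5 + (a 7 : ℝ) * zetaValue 7))) := by
  have hb' := hb
  obtain ⟨h0, hj⟩ := hb'
  set B := (b 0).toNat with hB
  have hb0 : (b 0 : ℤ) = (B : ℤ) := (Int.toNat_of_nonneg h0).symm
  have hS : ∑ j ∈ range 9, b (j + 1) = ((∑ j ∈ range 9, (b (j + 1)).toNat : ℕ) : ℤ) := by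
    rw [Nat.cast_sum]
    exact sum_congr rfl fun j hj' => (Int.toNat_of_nonneg (hj j hj').1).symm
  have hdeg : (numPoly b).natDegree + 2 ≤ 8 * (B + 1) := by
    have h1 := natDegree_numPoly_le b
    have h2 : ((∑ j ∈ range 9, (b (j + 1)).toNat : ℕ) : ℤ) ≤ 4 * (B : ℤ) + 2 := by
      rw [← hS, ← hb0]; exact hsum
    omega
  obtain ⟨a, ha⟩ := theoreme1_holds B 8 (numPoly b) (by norm_num) hdeg (numPoly_reflect b hb)
  refine ⟨a, ?_⟩
  have hfun : term b = fun k : ℕ => (aeval ((k : ℝ) + 1) (numPoly b)) / poch (k + 1) B ^ 8 :=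
    funext fun k => term_eq b hb k
  rw [hfun]
  rw [filter_odd_Icc_three_eight, sum_insert (by decide), sum_pair (by norm_num)] at ha
  exact ha

/-- CONVERGENCE of (34) (`k = 9`) on the box with `Σ_j b_j ≤ 4b₀ + 2`. -/
theorem summable_term (b : ℕ → ℤ) (hb : InBox b) (hsum : ∑ j ∈ range 9, b (j + 1) ≤ 4 * b 0 + 2) :
    Summable (term b) := by
  obtain ⟨a, ha⟩ := exists_hasSum_term b hb hsum
  exact ha.summable

/-- DECOMPOSITION for `k = 9` (the T2-lane object): on the box with `Σ_j b_j ≤ 4b₀ + 2`,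
`F̃₉(b) = u·ζ(7) + w·ζ(5) + x·ζ(3) − v` for some rationals `u, w, x, v`, and the series (34) converges to it —
linear forms in `1, ζ(3), ζ(5), ζ(7)` (Zudilin 2004 §8 / Brown–Zudilin §12's window; the `ζ(3)`-free
combinations and the arithmetic normalisation are NOT claimed here). -/
theorem vwpDual_nine_mem (b : ℕ → ℤ) (hb : InBox b) (hsum : ∑ j ∈ range 9, b (j + 1) ≤ 4 * b 0 + 2) :
    ∃ u w x v : ℚ,
      HasSum (term b) ((u : ℝ) * zetaValue 7 + w * zetaValue 5 + x * zetaValue 3 - v) ∧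
        vwpDual 9 b = u * zetaValue 7 + w * zetaValue 5 + x * zetaValue 3 - v := by
  obtain ⟨a, ha⟩ := exists_hasSum_term b hb hsum
  have hval : ((a 0 : ℝ) + ((a 3 : ℝ) * zetaValue 3 + ((a 5 : ℝ) * zetaValue 5 + (a 7 : ℝ) * zetaValue 7))) =
      (a 7 : ℝ) * zetaValue 7 + (a 5 : ℝ) * zetaValue 5 + (a 3 : ℝ) * zetaValue 3 - ((-a 0 : ℚ) : ℝ) := by
    push_cast
    ring
  rw [hval] at ha
  exact ⟨a 7, a 5, a 3, -a 0, ha, by rw [vwpDual_nine_eq_tsum, ha.tsum_eq]⟩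

/-- The same decomposition as a four-term integer-coefficient-ready statement: `F̃₉(b)` is a `ℚ`-linear form in
`thetaFour = (1, ζ(3), ζ(5), ζ(7))` of `CriteriaDimension.lean` / the `θ` of `CriteriaOddZeta`, i.e. there is
`c : Fin 4 → ℚ` with `F̃₉(b) = Σ_i c_i · thetaFour i`. -/
theorem vwpDual_nine_mem_span (b : ℕ → ℤ) (hb : InBox b) (hsum : ∑ j ∈ range 9, b (j + 1) ≤ 4 * b 0 + 2) :
    ∃ c : Fin 4 → ℚ, vwpDual 9 b = ∑ i, (c i : ℝ) * thetaFour i := by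
  obtain ⟨u, w, x, v, -, h⟩ := vwpDual_nine_mem b hb hsum
  refine ⟨![-v, x, w, u], ?_⟩
  rw [h, Fin.sum_univ_four]
  simp [thetaFour]
  ring

end Summit.KontsevichZagierPeriods.Zeta5Search.DualSeriesNine
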